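import Summits.HodgeConjecture.HodgeConjecture.Theorems.R90S6MacdonaldRankOne    -- W8-g: `doubleCosetOperator_torusGen_mul_pow/_self`, `satakeTransform_…_torusGen_pow_succ`, `torusGen_eq_basic`
import HarnessLib

/-!
# R90 · S6 — card F2′ «MACDONALD CLOSED FORM, N = 3»: the Satake transforms `𝒮(1_{K₀ tᵐ K₀})` of the unramified `U(3)` as EXPLICIT
# `W`-invariant Laurent polynomials, `𝒮(φ_m) = h_m + (√Q − 1) h_{m−1} − √Q h_{m−2}`, `h_j = Q^j Σ_{i=0}^{j} x^{ℓ_{2i−j}}`, and the eigenvalues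
# `λ_β(φ_m)` in Chebyshev-`U` shape (`Theorems/R90S6MacdonaldClosedForm.lean`)

Cell `hodgecm-mathlib`, crux H413 (`stmt-HodgeConjecture-24833`), route `HCCMUnconditional`; R90-TF section S6 (base `R90-C14`), seat R90-C14-p09 (g0); card F2′
(dealer R90-C14-plan (g2), R90 bus 2026-09-05T00:1xZ, DAG r5 row E1.3.2.1 «𝒮(φ_m) … as explicit W-invariant Laurent polynomials»).  Lane `--supports
stmt-HodgeConjecture-24833 --as helper`; ONE definition with body (`macdonaldSum`, the complete homogeneous sums — bookkeeping data, not a predicate) +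
theorems; no instance, no notation, no named fact, no `sorry`; imports = ★ W8-g `Theorems.R90S6MacdonaldRankOne` + HarnessLib.

THE PRINT.  [Macdonald1971, Ch. V §3 (3.4)]: on a semi-homogeneous tree the zonal spherical function is `ω_z(tᵐ) = c(z) zᵐ + c(z⁻¹) z⁻ᵐ` with an explicit
`c`-function; equivalently the Hecke eigenvalues `s_m = λ_z(1_{K tᵐ K})` have generating function `Σ s_m Tᵐ = (1 + bT)(1 − T) ∕ ((1 − uT)(1 − vT))`,
`u + v = λ_z(1_{KtK}) − (b − 1)`, `uv = ab`.  For the hyperspecial vertex of the unramified `U(3)` (`(a, b) = (q_v³, q_v)`, `Q = q_v²`): `u = Q z`,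
`v = Q z⁻¹`, so `s_m = h_m + (√Q − 1) h_{m−1} − √Q h_{m−2}` with `h_j = Σ_i uⁱ v^{j−i} = Q^j Σ_{i=0}^{j} z^{2i−j}`.  [CartierCorvallis1979, §IV (4.2), Thm. 4.1–4.2].

WHAT IS PROVED (frame of ★ `UnitaryRankOneBasicHeckeOperator`: `hd : UnramifiedLocalConjDatum σ ϖ`, `σ ≠ id`, `[Finite 𝓀[K]]`, the Hecke pair; `φ_m =
doubleCosetOperator K₀ (hd.torusGen ^ m)`; the line `ℓ_k = (k(1−t))_t` as there):
* §1 `macdonaldSum Q j = Q^j Σ_{i≤j} x^{ℓ_{2i−j}}` and its algebra in `ℂ[ℤ³]`: `macdonaldSum_zero` (`= 1`), `macdonaldSum_one` (`= Q(x^{ℓ₁}+x^{ℓ₋₁})`),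
  **`macdonaldSum_succ_succ`** (`h_{j+2} = Q(x^{ℓ₁}+x^{ℓ₋₁}) h_{j+1} − Q² h_j`), **`macdonaldSum_succ_succ_sub`** (`h_{j+2} − Q² h_j = Q^{j+2}(x^{ℓ_{j+2}} + x^{ℓ_{−j−2}})`,
  the orbit sums — the input of the inverse expansion).
* §2 the pure recursion algebra (`macdonald_base_two`, `macdonald_step`, **`eq_macdonaldSum_of_recursion`**) and the closed form
  **`satakeTransform_doubleCosetOperator_torusGen_pow_eq`**: `𝒮(φ_m) = h_m + (√Q − 1)·h_{m−1} − √Q·h_{m−2}` for `m ≥ 2` (+ `…_torusGen_eq_macdonaldSum`, m = 1),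
  from ★ `satakeTransform_doubleCosetOperator_torusGen_pow_succ`, ★ `doubleCosetOperator_torusGen_mul_self`, ★ `satakeTransform_doubleCosetOperator_basic_three`.
* §3 **`heckeEigencharacter_doubleCosetOperator_torusGen_pow_eq`**: `λ_β(φ_m) = Q^m 𝒰_m(z) + (√Q−1) Q^{m−1} 𝒰_{m−1}(z) − √Q Q^{m−2} 𝒰_{m−2}(z)`,
  `𝒰_j(z) = Σ_{i=0}^{j} z^{2i−j}` (`= U_j` Chebyshev of the second kind in `(z+z⁻¹)/2`), `z = β₀β₂⁻¹` (`laurentEvalAt_macdonaldSum`, `prod_zpow_lineThree`).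
HONEST LABEL: local spherical Hecke-algebra algebra; proves no printed global statement, discharges no citation; count-neutral helper until E1.3.5.2.5 ∕
E1.4.4.2.3 consume it.  HC_CM is proved only modulo the 7 printed citations (2 remaining named inputs: hLiu418 = stmt-HodgeConjecture-24832, h413 =
stmt-HodgeConjecture-24833) until rung 0 closes; REL ≠ ★ ≠ BUILT.

## Tree search
★ `doubleCosetOperator_torusGen_mul_self`, `satakeTransform_doubleCosetOperator_torusGen_pow_succ`, `torusGen_eq_basic`, `algHom_apply_add_smul_add_smul`,
`natCast_sqrt_card_sub_one` [Theorems/R90S6MacdonaldRankOne, p863499]; ★ `satakeTransform_doubleCosetOperator_basic_three`, `rev_linear_three`; ★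
`heckeEigencharacter_apply`, `laurentEvalAt_single`; Mathlib `Finset.sum_range_succ(')`, `AddMonoidAlgebra.single_mul_single`, `Fin.prod_univ_three`.
Dedup: `rg "macdonaldSum|torusGen_pow_eq|ClosedForm"` over `lean/` — no hit.

## References
* [Macdonald1971] I. G. Macdonald, *Spherical functions on a group of p-adic type*, Ramanujan Inst. Publ. 2 (1971), Ch. V §3, (3.4).
* [CartierCorvallis1979] P. Cartier, *Representations of 𝔭-adic groups: a survey*, PSPM 33.1 (1979), §IV (4.2)–(4.4), Thm. 4.1, Thm. 4.2.
* [Rogawski1990] J. D. Rogawski, *Automorphic Representations of Unitary Groups in Three Variables*, Ann. of Math. Stud. 123 (1990), §4.5 p. 50.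
-/

set_option autoImplicit false
-- the mandated namespace repeats the single-problem summit's segment (`HodgeConjecture.HodgeConjecture`)
set_option linter.dupNamespace false

noncomputable section

open scoped Valued WithZero Matrix MatrixGroups Pointwise
open MulAction Finset

namespace Summit.HodgeConjecture.HodgeConjecture.R90.S6

open Literature.NumberTheory.Automorphic Literature.NumberTheory.Automorphic.HermitianLattice
  Literature.NumberTheory.Automorphic.HermitianLattice.UnramifiedLocalConjDatum Literature.NumberTheory.Automorphic.CartanUnique
  Literature.NumberTheory.Automorphic.SymplecticCartan Literature.NumberTheory.Automorphic.heckeAlgebra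

/-! ## §1 The complete homogeneous sums `h_j = Q^j Σ_{i=0}^{j} x^{ℓ_{2i−j}}` (`= Σ_i uⁱ v^{j−i}`, `u = Q x^{ℓ₁}`, `v = Q x^{ℓ₋₁}`) -/

/-- **Macdonald's complete homogeneous sums on the line `ℓ_k = (k, 0, −k)`**: `h_j = Q^j · Σ_{i=0}^{j} x^{ℓ_{2i−j}} = Σ_{i=0}^{j} (Q x^{ℓ₁})ⁱ (Q x^{ℓ₋₁})^{j−i}`
in `ℂ[ℤ³]` — the building blocks of the closed form `𝒮(1_{K₀ tʲ K₀}) = h_j + (√Q − 1) h_{j−1} − √Q h_{j−2}` (`h_j = (u^{j+1} − v^{j+1}) ∕ (u − v)`, `u, v` the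
two roots of Macdonald's recurrence). [cite: Macdonald1971, Ch. V §3] [cite: CartierCorvallis1979, §IV (4.2)] -/
def macdonaldSum (Q : ℂ) (j : ℕ) : AddMonoidAlgebra ℂ (Fin 3 → ℤ) :=
  ∑ i ∈ range (j + 1), (Q ^ j) • AddMonoidAlgebra.single (fun t : Fin 3 => (2 * (i : ℤ) - (j : ℤ)) * (1 - (t : ℕ))) (1 : ℂ)

/-- The line `k ↦ ℓ_k = (k(1 − t))_t` is additive. [folklore] -/
theorem lineThree_add (a b : ℤ) :
    (fun t : Fin 3 => (a + b) * (1 - (t : ℕ))) = (fun t : Fin 3 => a * (1 - (t : ℕ))) + fun t : Fin 3 => b * (1 - (t : ℕ)) := by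
  funext t; simp only [Pi.add_apply]; ring

/-- `x^{ℓ_a} · x^{ℓ_b} = x^{ℓ_{a+b}}` with coefficients. [folklore] -/
theorem single_lineThree_mul (a b : ℤ) (r s : ℂ) :
    AddMonoidAlgebra.single (fun t : Fin 3 => a * (1 - (t : ℕ))) r * AddMonoidAlgebra.single (fun t : Fin 3 => b * (1 - (t : ℕ))) s =
      AddMonoidAlgebra.single (fun t : Fin 3 => (a + b) * (1 - (t : ℕ))) (r * s) := by
  rw [AddMonoidAlgebra.single_mul_single, lineThree_add]

/-- `x^{ℓ_a} = x^{ℓ_b}` for `a = b` (exponent bookkeeping under the binder). [folklore] -/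
theorem single_lineThree_congr {a b : ℤ} (h : a = b) (r : ℂ) :
    AddMonoidAlgebra.single (fun t : Fin 3 => a * (1 - (t : ℕ))) r = AddMonoidAlgebra.single (fun t : Fin 3 => b * (1 - (t : ℕ))) r := by
  rw [h]

/-- `h_0 = 1`. [cite: Macdonald1971, Ch. V §3] -/
theorem macdonaldSum_zero (Q : ℂ) : macdonaldSum Q 0 = 1 := by
  rw [macdonaldSum, zero_add, sum_range_one, pow_zero, one_smul, AddMonoidAlgebra.one_def]
  congr 1
  funext t; simp

/-- `h_1 = Q · (x^{ℓ₁} + x^{ℓ₋₁})`. [cite: Macdonald1971, Ch. V §3] -/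
theorem macdonaldSum_one (Q : ℂ) :
    macdonaldSum Q 1 = Q • (AddMonoidAlgebra.single (fun t : Fin 3 => (1 : ℤ) * (1 - (t : ℕ))) (1 : ℂ) +
      AddMonoidAlgebra.single (fun t : Fin 3 => (-1 : ℤ) * (1 - (t : ℕ))) 1) := by
  rw [macdonaldSum, sum_range_succ, sum_range_one, pow_one, ← smul_add, add_comm,
    single_lineThree_congr (show 2 * ((1 : ℕ) : ℤ) - ((1 : ℕ) : ℤ) = 1 by norm_num),
    single_lineThree_congr (show 2 * ((0 : ℕ) : ℤ) - ((1 : ℕ) : ℤ) = -1 by norm_num)]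

/-- **THE RECURRENCE OF THE `h_j`**: `h_{j+2} = Q (x^{ℓ₁} + x^{ℓ₋₁}) · h_{j+1} − Q² · h_j` (`u + v = Q(x^{ℓ₁}+x^{ℓ₋₁})`, `uv = Q²`).
[cite: Macdonald1971, Ch. V §3] -/
theorem macdonaldSum_succ_succ (Q : ℂ) (j : ℕ) :
    macdonaldSum Q (j + 2) =
      (Q • (AddMonoidAlgebra.single (fun t : Fin 3 => (1 : ℤ) * (1 - (t : ℕ))) (1 : ℂ) +
          AddMonoidAlgebra.single (fun t : Fin 3 => (-1 : ℤ) * (1 - (t : ℕ))) 1)) * macdonaldSum Q (j + 1) -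
        (Q ^ 2) • macdonaldSum Q j := by
  -- the product, monomial by monomial: `Σ_{i<j+2} Q^{j+2} x^{ℓ_{2i−j}} + Σ_{i<j+2} Q^{j+2} x^{ℓ_{2i−(j+2)}}`
  have hmul : (Q • (AddMonoidAlgebra.single (fun t : Fin 3 => (1 : ℤ) * (1 - (t : ℕ))) (1 : ℂ) +
        AddMonoidAlgebra.single (fun t : Fin 3 => (-1 : ℤ) * (1 - (t : ℕ))) 1)) * macdonaldSum Q (j + 1) =
      (∑ i ∈ range (j + 2), (Q ^ (j + 2)) • AddMonoidAlgebra.single (fun t : Fin 3 => (2 * (i : ℤ) - (j : ℤ)) * (1 - (t : ℕ))) (1 : ℂ)) +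
        ∑ i ∈ range (j + 2), (Q ^ (j + 2)) • AddMonoidAlgebra.single (fun t : Fin 3 => (2 * (i : ℤ) - ((j + 2 : ℕ) : ℤ)) * (1 - (t : ℕ))) (1 : ℂ) := by
    rw [macdonaldSum, mul_sum, ← sum_add_distrib]
    refine sum_congr rfl fun i _ => ?_
    rw [smul_mul_smul_comm, add_mul, single_lineThree_mul, single_lineThree_mul, one_mul, smul_add,
      show Q * Q ^ (j + 1) = Q ^ (j + 2) by ring,
      single_lineThree_congr (show (1 : ℤ) + (2 * (i : ℤ) - ((j + 1 : ℕ) : ℤ)) = 2 * (i : ℤ) - (j : ℤ) by push_cast; ring),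
      single_lineThree_congr (show (-1 : ℤ) + (2 * (i : ℤ) - ((j + 1 : ℕ) : ℤ)) = 2 * (i : ℤ) - ((j + 2 : ℕ) : ℤ) by push_cast; ring)]
  -- `Σ_{i<j+2} Q^{j+2} x^{ℓ_{2i−j}} = Q² h_j + Q^{j+2} x^{ℓ_{j+2}}`
  have hA : (∑ i ∈ range (j + 2), (Q ^ (j + 2)) • AddMonoidAlgebra.single (fun t : Fin 3 => (2 * (i : ℤ) - (j : ℤ)) * (1 - (t : ℕ))) (1 : ℂ)) =
      (Q ^ 2) • macdonaldSum Q j +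
        (Q ^ (j + 2)) • AddMonoidAlgebra.single (fun t : Fin 3 => (2 * ((j + 1 : ℕ) : ℤ) - (j : ℤ)) * (1 - (t : ℕ))) (1 : ℂ) := by
    rw [sum_range_succ, macdonaldSum, smul_sum]
    congr 1
    refine sum_congr rfl fun i _ => ?_
    rw [smul_smul, show Q ^ 2 * Q ^ j = Q ^ (j + 2) by ring]
  -- `h_{j+2} = Σ_{i<j+2} Q^{j+2} x^{ℓ_{2i−(j+2)}} + Q^{j+2} x^{ℓ_{j+2}}`
  have hB : macdonaldSum Q (j + 2) =
      (∑ i ∈ range (j + 2), (Q ^ (j + 2)) • AddMonoidAlgebra.single (fun t : Fin 3 => (2 * (i : ℤ) - ((j + 2 : ℕ) : ℤ)) * (1 - (t : ℕ))) (1 : ℂ)) +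
        (Q ^ (j + 2)) • AddMonoidAlgebra.single (fun t : Fin 3 => (2 * ((j + 2 : ℕ) : ℤ) - ((j + 2 : ℕ) : ℤ)) * (1 - (t : ℕ))) (1 : ℂ) := by
    rw [macdonaldSum, sum_range_succ]
  rw [hmul, hA, hB, single_lineThree_congr (show 2 * ((j + 2 : ℕ) : ℤ) - ((j + 2 : ℕ) : ℤ) = 2 * ((j + 1 : ℕ) : ℤ) - (j : ℤ) by push_cast; ring)]
  abel

/-- **`h_{j+2} − Q² h_j = Q^{j+2} (x^{ℓ_{j+2}} + x^{ℓ_{−(j+2)}})`** — the orbit sums through the `h_j`. [cite: Macdonald1971, Ch. V §3] -/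
theorem macdonaldSum_succ_succ_sub (Q : ℂ) (j : ℕ) :
    macdonaldSum Q (j + 2) - (Q ^ 2) • macdonaldSum Q j =
      (Q ^ (j + 2)) • (AddMonoidAlgebra.single (fun t : Fin 3 => ((j : ℤ) + 2) * (1 - (t : ℕ))) (1 : ℂ) +
        AddMonoidAlgebra.single (fun t : Fin 3 => (-((j : ℤ) + 2)) * (1 - (t : ℕ))) 1) := by
  rw [sub_eq_iff_eq_add, macdonaldSum, sum_range_succ, sum_range_succ', macdonaldSum, smul_sum, smul_add,
    single_lineThree_congr (show 2 * ((j + 2 : ℕ) : ℤ) - ((j + 2 : ℕ) : ℤ) = (j : ℤ) + 2 by push_cast; ring),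
    single_lineThree_congr (show 2 * ((0 : ℕ) : ℤ) - ((j + 2 : ℕ) : ℤ) = -((j : ℤ) + 2) by push_cast; ring)]
  -- middle block: `i ↦ i + 1` matches `Q² h_j`
  have hmid : (∑ i ∈ range (j + 1), (Q ^ (j + 2)) • AddMonoidAlgebra.single (fun t : Fin 3 => (2 * ((i + 1 : ℕ) : ℤ) - ((j + 2 : ℕ) : ℤ)) * (1 - (t : ℕ))) (1 : ℂ)) =
      ∑ i ∈ range (j + 1), (Q ^ 2) • ((Q ^ j) • AddMonoidAlgebra.single (fun t : Fin 3 => (2 * (i : ℤ) - (j : ℤ)) * (1 - (t : ℕ))) (1 : ℂ)) := by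
    refine sum_congr rfl fun i _ => ?_
    rw [smul_smul, show Q ^ 2 * Q ^ j = Q ^ (j + 2) by ring,
      single_lineThree_congr (show 2 * ((i + 1 : ℕ) : ℤ) - ((j + 2 : ℕ) : ℤ) = 2 * (i : ℤ) - (j : ℤ) by push_cast; ring)]
  rw [hmid]
  abel

/-! ## §2 THE CLOSED FORM `𝒮(φ_m) = h_m + (√Q − 1) h_{m−1} − √Q h_{m−2}` -/

/-- Linear bookkeeping for an algebra hom on LIGHT carriers: `f (x + a • y + b • 1) = f x + a • f y + b • 1`. [folklore] -/
theorem algHom_apply_add_smul_add_smul_one {R A B : Type*} [CommSemiring R] [Semiring A] [Semiring B] [Algebra R A] [Algebra R B]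
    (f : A →ₐ[R] B) (x y : A) (a b : R) : f (x + a • y + b • 1) = f x + a • f y + b • 1 := by
  simp only [map_add, map_smul, map_one]

/-- The algebra of the base case `m = 2`: `S₁ = X + c·1`, `S₁² = S₂ + c S₁ + (D + q)·1` ⇒ `S₂ = (X² − D·1) + c X − q·1`. [cite: Macdonald1971, Ch. V §3] -/
theorem macdonald_base_two {A : Type*} [CommRing A] [Algebra ℂ A] (X S₁ S₂ : A) (c q D : ℂ) (e₁ : S₁ = X + c • 1)
    (e₂ : S₁ * S₁ = S₂ + c • S₁ + (D + q) • 1) : S₂ = (X * X - D • 1) + c • X - q • 1 := by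
  subst e₁
  simp only [Algebra.smul_def, map_add] at e₂ ⊢
  linear_combination -e₂

/-- The algebra of the induction step: three consecutive instances of the `h`-recurrence, the closed forms at `m`, `m+1` and the `S`-recurrence give
the closed form at `m+2`. [cite: Macdonald1971, Ch. V §3] -/
theorem macdonald_step {A : Type*} [CommRing A] [Algebra ℂ A] (X hm2 hm1 h0 h1 h2 Sa Sb Sc : A) (c q D : ℂ)
    (eh2 : h2 = X * h1 - D • h0) (eh1 : h1 = X * h0 - D • hm1) (eh0 : h0 = X * hm1 - D • hm2)
    (ea : Sa = h0 + c • hm1 - q • hm2) (eb : Sb = h1 + c • h0 - q • hm1) (ec : Sc = X * Sb - D • Sa) :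
    Sc = h2 + c • h1 - q • h0 := by
  subst ec eb ea eh2 eh1 eh0
  simp only [Algebra.smul_def]
  ring

/-- **THE CLOSED FORM FROM THE RECURRENCE (pure algebra in `ℂ[ℤ³]`)**: a sequence `S` with `S₁ = h₁ + (q−1)·h₀`,
`S₁² = S₂ + (q−1) S₁ + (Q² + q)·1` and `S_{n+1} = Q(x^{ℓ₁}+x^{ℓ₋₁}) S_n − Q² S_{n−1}` (`n ≥ 2`) is `S_m = h_m + (q−1) h_{m−1} − q h_{m−2}` for all `m ≥ 2`
(two-step induction on `macdonaldSum_succ_succ`). [cite: Macdonald1971, Ch. V §3] -/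
theorem eq_macdonaldSum_of_recursion (Q q : ℂ) (S : ℕ → AddMonoidAlgebra ℂ (Fin 3 → ℤ))
    (hS1 : S 1 = macdonaldSum Q 1 + (q - 1) • macdonaldSum Q 0)
    (hS2 : S 1 * S 1 = S 2 + (q - 1) • S 1 + (Q ^ 2 + q) • 1)
    (hrec : ∀ n, 2 ≤ n → S (n + 1) =
      (Q • (AddMonoidAlgebra.single (fun t : Fin 3 => (1 : ℤ) * (1 - (t : ℕ))) (1 : ℂ) +
          AddMonoidAlgebra.single (fun t : Fin 3 => (-1 : ℤ) * (1 - (t : ℕ))) 1)) * S n - (Q ^ 2) • S (n - 1))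
    {m : ℕ} (hm : 2 ≤ m) :
    S m = macdonaldSum Q m + (q - 1) • macdonaldSum Q (m - 1) - q • macdonaldSum Q (m - 2) := by
  have h0 : macdonaldSum Q 0 = 1 := macdonaldSum_zero Q
  have h1 := macdonaldSum_one Q
  have hH := macdonaldSum_succ_succ Q
  rw [h1, h0] at hS1
  -- two-step induction: `S (n+2)` and `S (n+3)`
  suffices key : ∀ n : ℕ, S (n + 2) = macdonaldSum Q (n + 2) + (q - 1) • macdonaldSum Q (n + 1) - q • macdonaldSum Q n ∧
      S (n + 3) = macdonaldSum Q (n + 3) + (q - 1) • macdonaldSum Q (n + 2) - q • macdonaldSum Q (n + 1) by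
    obtain ⟨n, rfl⟩ : ∃ n, m = n + 2 := ⟨m - 2, by omega⟩
    rw [show n + 2 - 1 = n + 1 by omega, show n + 2 - 2 = n by omega]
    exact (key n).1
  intro n
  induction n with
  | zero =>
    have e2 : S 2 = macdonaldSum Q 2 + (q - 1) • macdonaldSum Q 1 - q • macdonaldSum Q 0 := by
      rw [hH 0, h1, h0]
      exact macdonald_base_two _ _ _ _ _ _ hS1 hS2
    refine ⟨e2, ?_⟩
    have ec := hrec 2 le_rfl
    have eh0 : macdonaldSum Q 1 = (Q • (AddMonoidAlgebra.single (fun t : Fin 3 => (1 : ℤ) * (1 - (t : ℕ))) (1 : ℂ) +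
        AddMonoidAlgebra.single (fun t : Fin 3 => (-1 : ℤ) * (1 - (t : ℕ))) 1)) * macdonaldSum Q 0 -
          (Q ^ 2) • (0 : AddMonoidAlgebra ℂ (Fin 3 → ℤ)) := by
      rw [h1, h0, mul_one, smul_zero, sub_zero]
    have ea : S 1 = macdonaldSum Q 1 + (q - 1) • macdonaldSum Q 0 - q • (0 : AddMonoidAlgebra ℂ (Fin 3 → ℤ)) := by
      rw [hS1, h1, h0, smul_zero, sub_zero]
    exact macdonald_step _ _ _ _ _ _ _ _ _ _ _ _ (hH 1) (hH 0) eh0 ea e2 ec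
  | succ n ih =>
    obtain ⟨ihA, ihB⟩ := ih
    refine ⟨ihB, ?_⟩
    have ec := hrec (n + 3) (by omega)
    rw [show n + 3 - 1 = n + 2 by omega] at ec
    exact macdonald_step _ _ _ _ _ _ _ _ _ _ _ _ (hH (n + 2)) (hH (n + 1)) (hH n) ihA ihB ec

variable {K : Type*} [Field K] [Valued K ℤᵐ⁰] {σ : K →+* K} {ϖ : K} [Finite 𝓀[K]]
  [IsHeckeTriple (⊤ : Submonoid (unitaryGroupOfForm σ ((StdForm.antidiagonal 3).over K))) (unitaryInt σ ((StdForm.antidiagonal 3).over K))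
    (unitaryInt σ ((StdForm.antidiagonal 3).over K))]

/-- `𝒮(φ₁) = h_1 + (√Q − 1)·h_0` (★ `satakeTransform_doubleCosetOperator_basic_three` in `h`-letters). [cite: CartierCorvallis1979, §IV (4.2)] -/
theorem satakeTransform_doubleCosetOperator_torusGen_eq_macdonaldSum (hd : UnramifiedLocalConjDatum σ ϖ) (hσ : ∃ x : K, σ x ≠ x) :
    hd.satakeTransform (doubleCosetOperator (unitaryInt σ ((StdForm.antidiagonal 3).over K)) hd.torusGen) =
      macdonaldSum (Nat.card 𝓀[K] : ℂ) 1 + ((Nat.sqrt (Nat.card 𝓀[K]) : ℂ) - 1) • macdonaldSum (Nat.card 𝓀[K] : ℂ) 0 := by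
  rw [torusGen_eq_basic, hd.satakeTransform_doubleCosetOperator_basic_three hσ, macdonaldSum_one, macdonaldSum_zero,
    Algebra.algebraMap_eq_smul_one]

/-- **MACDONALD'S FORMULA FOR THE UNRAMIFIED `U(3)` (hyperspecial level), CLOSED FORM**: for `m ≥ 2`,
`𝒮(1_{K₀ tᵐ K₀}) = h_m + (√Q − 1) · h_{m−1} − √Q · h_{m−2}`, `h_j = Q^j Σ_{i=0}^{j} x^{ℓ_{2i−j}}` (`macdonaldSum`) — equivalently the generating function
`Σ_m 𝒮(φ_m) Tᵐ = (1 + √Q T)(1 − T) ∕ ((1 − Q x^{ℓ₁} T)(1 − Q x^{ℓ₋₁} T))`, Macdonald's `c`-function factorisation on the `(q_v³+1, q_v+1)`-tree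
(`Q = q_v²`).  Coefficients: `Q^m` at `x^{ℓ_{±m}}`, `Q^m − √Q·Q^{m−2}` at `x^{ℓ_k}` (`|k| ≤ m−2`, `k ≡ m (2)`), `(√Q − 1) Q^{m−1}` at `x^{ℓ_k}` (`|k| ≤ m−1`,
`k ≢ m (2)`).  Proof: `eq_macdonaldSum_of_recursion` on ★ `satakeTransform_doubleCosetOperator_torusGen_pow_succ`, ★ `doubleCosetOperator_torusGen_mul_self`.
[cite: Macdonald1971, Ch. V §3 (3.4)] [cite: CartierCorvallis1979, §IV (4.2), Thm. 4.1] [cite: Rogawski1990, §4.5 p. 50] -/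
theorem satakeTransform_doubleCosetOperator_torusGen_pow_eq (hd : UnramifiedLocalConjDatum σ ϖ) (hσ : ∃ x : K, σ x ≠ x) {m : ℕ} (hm : 2 ≤ m) :
    hd.satakeTransform (doubleCosetOperator (unitaryInt σ ((StdForm.antidiagonal 3).over K)) (hd.torusGen ^ m)) =
      macdonaldSum (Nat.card 𝓀[K] : ℂ) m + ((Nat.sqrt (Nat.card 𝓀[K]) : ℂ) - 1) • macdonaldSum (Nat.card 𝓀[K] : ℂ) (m - 1) -
        (Nat.sqrt (Nat.card 𝓀[K]) : ℂ) • macdonaldSum (Nat.card 𝓀[K] : ℂ) (m - 2) := by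
  refine eq_macdonaldSum_of_recursion (Nat.card 𝓀[K] : ℂ) (Nat.sqrt (Nat.card 𝓀[K]) : ℂ)
    (fun n => hd.satakeTransform (doubleCosetOperator (unitaryInt σ ((StdForm.antidiagonal 3).over K)) (hd.torusGen ^ n))) ?_ ?_ ?_ hm
  · simp only [pow_one]
    exact satakeTransform_doubleCosetOperator_torusGen_eq_macdonaldSum hd hσ
  · have h := congrArg hd.satakeTransform (doubleCosetOperator_torusGen_mul_self (k := ℂ) hd hσ)
    rw [map_mul, algHom_apply_add_smul_add_smul_one, natCast_sqrt_card_sub_one, Nat.cast_add, Nat.cast_pow] at h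
    simp only [pow_one]
    exact h
  · intro n hn
    have h := satakeTransform_doubleCosetOperator_torusGen_pow_succ hd hσ hn
    rw [Nat.cast_pow] at h
    exact h

/-! ## §3 The eigenvalues: `λ_β(φ_m) = Q^m 𝒰_m(z) + (√Q − 1) Q^{m−1} 𝒰_{m−1}(z) − √Q Q^{m−2} 𝒰_{m−2}(z)`, `𝒰_j(z) = Σ_{i=0}^{j} z^{2i−j}` -/

omit [Finite 𝓀[K]]
  [IsHeckeTriple (⊤ : Submonoid (unitaryGroupOfForm σ ((StdForm.antidiagonal 3).over K))) (unitaryInt σ ((StdForm.antidiagonal 3).over K))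
    (unitaryInt σ ((StdForm.antidiagonal 3).over K))] in
/-- `x^{ℓ_k}` at the torus parameter `β`: `Π_t β_t^{k(1−t)} = (β₀β₂⁻¹)^k = z^k`. [cite: CartierCorvallis1979, §IV (4.2)–(4.4)] -/
theorem prod_zpow_lineThree (β : Fin 3 → ℂˣ) (k : ℤ) :
    (∏ t : Fin 3, ((β t : ℂ) ^ ((fun t : Fin 3 => k * (1 - ((t : ℕ) : ℤ))) t))) = ((β 0 : ℂ) * (β 2 : ℂ)⁻¹) ^ k := by
  rw [Fin.prod_univ_three]
  simp only [Fin.val_zero, Fin.val_one, Fin.val_two, Nat.cast_zero, Nat.cast_one, Nat.cast_ofNat, sub_zero, sub_self, mul_one, mul_zero,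
    zpow_zero, show (1 : ℤ) - 2 = -1 by norm_num, mul_neg, zpow_neg, mul_zpow, inv_zpow]

omit [Finite 𝓀[K]]
  [IsHeckeTriple (⊤ : Submonoid (unitaryGroupOfForm σ ((StdForm.antidiagonal 3).over K))) (unitaryInt σ ((StdForm.antidiagonal 3).over K))
    (unitaryInt σ ((StdForm.antidiagonal 3).over K))] in
/-- **`h_j` at the torus parameter `β`**: `h_j(β) = Q^j · Σ_{i=0}^{j} z^{2i−j}` (`z = β₀β₂⁻¹`; `= Q^j U_j((z+z⁻¹)/2)`, Chebyshev of the second kind).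
[cite: Macdonald1971, Ch. V §3] [cite: CartierCorvallis1979, §IV (4.2)–(4.4)] -/
theorem laurentEvalAt_macdonaldSum (β : Fin 3 → ℂˣ) (Q : ℂ) (j : ℕ) :
    laurentEvalAt β (macdonaldSum Q j) = Q ^ j * ∑ i ∈ range (j + 1), ((β 0 : ℂ) * (β 2 : ℂ)⁻¹) ^ (2 * (i : ℤ) - (j : ℤ)) := by
  rw [macdonaldSum, map_sum, mul_sum]
  refine sum_congr rfl fun i _ => ?_
  rw [map_smul, laurentEvalAt_single, one_mul, prod_zpow_lineThree, smul_eq_mul]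

/-- **MACDONALD'S SPHERICAL FUNCTION OF THE UNRAMIFIED `U(3)` — the eigenvalues in closed form** (`m ≥ 2`, `z = β₀β₂⁻¹`, `𝒰_j(z) = Σ_{i=0}^{j} z^{2i−j}`):
`λ_β(1_{K₀ tᵐ K₀}) = Q^m 𝒰_m(z) + (√Q − 1) Q^{m−1} 𝒰_{m−1}(z) − √Q · Q^{m−2} 𝒰_{m−2}(z)`; dividing by the degree `#(K₀tᵐK₀∕K₀)` gives Macdonald's
`c(z) zᵐ + c(z⁻¹) z⁻ᵐ`-shape spherical function. [cite: Macdonald1971, Ch. V §3 (3.4)] [cite: CartierCorvallis1979, §IV (4.2)–(4.4), Thm. 4.2]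
[cite: Rogawski1990, §4.5 p. 50] -/
theorem heckeEigencharacter_doubleCosetOperator_torusGen_pow_eq (hd : UnramifiedLocalConjDatum σ ϖ) (hσ : ∃ x : K, σ x ≠ x)
    (β : Fin 3 → ℂˣ) {m : ℕ} (hm : 2 ≤ m) :
    hd.heckeEigencharacter β (doubleCosetOperator (unitaryInt σ ((StdForm.antidiagonal 3).over K)) (hd.torusGen ^ m)) =
      (Nat.card 𝓀[K] : ℂ) ^ m * (∑ i ∈ range (m + 1), ((β 0 : ℂ) * (β 2 : ℂ)⁻¹) ^ (2 * (i : ℤ) - (m : ℤ))) +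
        ((Nat.sqrt (Nat.card 𝓀[K]) : ℂ) - 1) *
          ((Nat.card 𝓀[K] : ℂ) ^ (m - 1) * ∑ i ∈ range (m - 1 + 1), ((β 0 : ℂ) * (β 2 : ℂ)⁻¹) ^ (2 * (i : ℤ) - ((m - 1 : ℕ) : ℤ))) -
        (Nat.sqrt (Nat.card 𝓀[K]) : ℂ) *
          ((Nat.card 𝓀[K] : ℂ) ^ (m - 2) * ∑ i ∈ range (m - 2 + 1), ((β 0 : ℂ) * (β 2 : ℂ)⁻¹) ^ (2 * (i : ℤ) - ((m - 2 : ℕ) : ℤ))) := by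
  rw [hd.heckeEigencharacter_apply, satakeTransform_doubleCosetOperator_torusGen_pow_eq hd hσ hm, map_sub, map_add, map_smul, map_smul,
    laurentEvalAt_macdonaldSum, laurentEvalAt_macdonaldSum, laurentEvalAt_macdonaldSum, smul_eq_mul, smul_eq_mul]

end Summit.HodgeConjecture.HodgeConjecture.R90.S6

end
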